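import Literature.Topology.FourManifolds.BandSum
import Literature.Topology.FourManifolds.GluckTwistTransport
import Literature.Topology.FourManifolds.IsotopyProofs
import HarnessLib

/-!
# Band sums depend only on the band: reduction of `BandData.isIsotopic_of_band_eq`

The named fact `Literature.Topology.FourManifolds.BandData.isIsotopic_of_band_eq` (`BandSum.lean`: two band sums of `K₁`,
`K₂` with the same band map and collar width are isotopic knots) is a folklore theorem of
geometric topology whose formal proof is a theory (isotopy extension, diffeotopies of the
circle, the smooth planar arc lemma, transport of planar diffeotopies along an embedded
surface). This file records the first step of its proof as a **reduction to two named facts**,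
separating the set-level geometry from the parametrisations:

* `Literature.Knot.SameOrientationAt f g`: two parametrised closed curves `f g : 𝕊 1 → 𝕊 3` pass
  through a common point with positively proportional velocities (definition, with `refl`,
  `of_eq`, `symm`);
* `Literature.Topology.FourManifolds.Knot.isIsotopic_of_range_eq` (named fact): two knots with the same image inducing the
  same orientation on it are isotopic — the oriented knot type depends only on the oriented
  image (reparametrisation `K⁻¹ ∘ K'` is an orientation-preserving diffeomorphism of `𝕊 1`,
  diffeotopic to the identity by Hirsch (1976), Thm. 8.3.3, and the isotopy `K ∘ ρ_t` of the
  compact submanifold extends to a diffeotopy of `𝕊 3` by Thm. 8.1.3);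
* `Literature.Topology.FourManifolds.BandData.exists_ambientIsotopy_of_band_eq` (named fact): for two band-sum data with the
  same band and collar width there is an ambient isotopy of `𝕊 3`, supported in any
  prescribed neighbourhood of the closure of the band surface, carrying the image of the first
  result onto the image of the second with the same orientation (the geometric heart: the two
  arc systems are isotopic rel endpoints in the two half-rectangles, and the planar diffeotopy,
  transported by `band` and tapered off normally, extends to `𝕊 3`);
* `Literature.Topology.FourManifolds.BandData.isIsotopic_of_band_eq_of` (proved): the two named facts imply
  `BandData.isIsotopic_of_band_eq` (compose: `K` is isotopic to its image
  `K.map (F.toDiffeomorph 1) = F₁ ∘ K` under the final stage by `F` itself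
  (`SphereEmbedding.map`, `SphereEmbedding.isIsotopic_map` of `GluckTwistTransport.lean`),
  `F₁ ∘ K` and `K'` have the same oriented image, and ambient isotopy is transitive,
  `IsAmbientIsotopic.trans_holds` of `IsotopyProofs.lean`); plus the simp lemma
  `SphereEmbedding.map_refl`.

## Sources

* R. E. Gompf, A. I. Stipsicz, *4-Manifolds and Kirby Calculus*, AMS GSM 20 (1999), §5.1,
  Fig. 5.7 (handle slides as band sums; the band sum along a given band as a well-defined
  operation). R. C. Kirby, *The Topology of 4-Manifolds*, LNM 1374 (1989), Ch. I §2, p. 10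
  ("the band-connected sum can be done along any band").
* M. W. Hirsch, *Differential Topology*, GTM 33 (1976), Ch. 8: Thm. 8.1.3 (isotopy extension,
  p. 180), Thm. 8.3.1 (embeddings of discs are ambient isotopic, p. 185), Thm. 8.3.3 (every
  diffeomorphism of `S¹` is isotopic to the identity or to complex conjugation, p. 186).
* D. Rolfsen, *Knots and Links* (1976), §1.A, §2.G.

## Design choices

* `SameOrientationAt` is stated for bare maps `𝕊 1 → 𝕊 3` (not for `Knot`), so that it applies
  verbatim to the composite `F.toFun 1 ∘ K` of a knot with a stage of an ambient isotopy, and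
  velocities are compared in `ℝ⁴ ⊇ 𝕊 3` after the parametrisation `circlePoint`, exactly as in
  the orientation clauses of `BandData`. For immersed curves (knots, and diffeomorphic images of
  knots) the velocities are nonzero, so the clause is not vacuous; for non-differentiable maps
  Mathlib's `deriv` is the junk value `0` and the clause degenerates (documented, harmless:
  both named facts only apply it to smooth immersed curves).
* The support clause of `BandData.exists_ambientIsotopy_of_band_eq` quantifies over open sets
  containing the **closure** of the band surface `b.support = band '' squareNhd δ` (for a
  neighbourhood of the non-closed surface itself the claim would be false: the isotopy must
  move points at a definite normal distance from the arcs).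
-/

open scoped Manifold ContDiff Topology
open Function Set

noncomputable section

namespace Literature.Topology.FourManifolds

/-- Local notation: `𝔼 n` is the model Euclidean space `EuclideanSpace ℝ (Fin n)`. -/
local notation "𝔼 " n:arg => EuclideanSpace ℝ (Fin n)

/-- Local notation: `𝕊 n` is the unit sphere in `EuclideanSpace ℝ (Fin (n + 1))`. -/
local notation "𝕊 " n:arg => (Metric.sphere (0 : EuclideanSpace ℝ (Fin (n + 1))) 1)

/-! ## Images of sphere embeddings under the identity -/

namespace SphereEmbedding

variable {k n : ℕ}

/-- The image of a sphere embedding under the identity diffeomorphism is itself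
(`SphereEmbedding.map` of `GluckTwistTransport.lean`). [folklore] -/
@[simp]
theorem map_refl (K : SphereEmbedding k n) : K.map (Diffeomorph.refl (𝓡 n) (𝕊 n) ∞) = K :=
  SphereEmbedding.ext (funext fun _ ↦ rfl)

end SphereEmbedding

namespace Knot

/-! ## Curves inducing the same orientation -/

/-- The parametrised closed curves `f g : 𝕊 1 → 𝕊 3` **induce the same orientation at a common
point**: there are parameters `θ`, `θ'` with `f (circlePoint θ) = g (circlePoint θ')` at which
the velocity of `t ↦ f (circlePoint t)` is a positive multiple of the velocity of
`t ↦ g (circlePoint t)` (both computed in `ℝ⁴ ⊇ 𝕊 3`, as in the orientation clauses of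
`BandData`). For two knots with the same image this says that the orientation-classes of the
two parametrisations agree (the reparametrisation `f⁻¹ ∘ g` is increasing at `circlePoint θ'`,
hence an orientation-preserving homeomorphism of the circle). For maps that are not
differentiable along `circlePoint` Mathlib's `deriv` is `0` and the condition degenerates; it
is only used for smooth immersed curves. Rolfsen (1976), §1.A (oriented knots). [folklore] -/
def SameOrientationAt (f g : 𝕊 1 → 𝕊 3) : Prop :=
  ∃ θ θ' c : ℝ, 0 < c ∧ f (circlePoint θ) = g (circlePoint θ') ∧
    deriv (fun t ↦ ((f (circlePoint t) : 𝕊 3) : 𝔼 4)) θ =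
      c • deriv (fun t ↦ ((g (circlePoint t) : 𝕊 3) : 𝔼 4)) θ'

/-- A curve induces the same orientation as itself (take `θ = θ' = 0`, `c = 1`). [folklore] -/
theorem SameOrientationAt.refl (f : 𝕊 1 → 𝕊 3) : SameOrientationAt f f :=
  ⟨0, 0, 1, one_pos, rfl, (one_smul _ _).symm⟩

/-- Equal curves induce the same orientation. [folklore] -/
theorem SameOrientationAt.of_eq {f g : 𝕊 1 → 𝕊 3} (h : f = g) : SameOrientationAt f g :=
  h ▸ SameOrientationAt.refl f

/-- Symmetry: if the velocity of `f` at `θ` is `c` times the velocity of `g` at `θ'` with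
`0 < c`, then the velocity of `g` at `θ'` is `c⁻¹` times that of `f` at `θ`. [folklore] -/
theorem SameOrientationAt.symm {f g : 𝕊 1 → 𝕊 3} (h : SameOrientationAt f g) :
    SameOrientationAt g f := by
  obtain ⟨θ, θ', c, hc, hfg, hderiv⟩ := h
  refine ⟨θ', θ, c⁻¹, inv_pos.2 hc, hfg.symm, ?_⟩
  rw [hderiv, smul_smul, inv_mul_cancel₀ hc.ne', one_smul]

/-! ## The oriented knot type depends only on the oriented image -/

/-- **Knots with the same oriented image are isotopic.** If two knots `K K' : 𝕊 1 ↪ 𝕊 3` have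
the same image and induce the same orientation on it at one common point, then they are
(ambient) isotopic. This is the standard consequence of two theorems of Hirsch (1976), Ch. 8:
`ρ := K⁻¹ ∘ K'` is a diffeomorphism of `𝕊 1` (inverse function theorem for the embedding
`K`), orientation preserving at `circlePoint θ'` by the velocity condition, hence everywhere
(`𝕊 1` is connected); by Hirsch (1976), Thm. 8.3.3 (the degree-one case of its proof; planned
as a separate named fact `Diffeomorph.isIsotopic_refl_of_hasDegreeOne` in a sibling file
`CircleDiffeotopy.lean`, proposed separately) it is isotopic to the identity through
diffeomorphisms `ρ_t`, so `t ↦ K ∘ ρ_t` is an isotopy of the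
compact submanifold `K` from `K` to `K'`, which extends to a diffeotopy of the closed manifold
`𝕊 3` by the isotopy extension theorem, Hirsch (1976), Thm. 8.1.3 (the tree's named fact
`Literature.Topology.FourManifolds.isAmbientIsotopic_of_isSmoothlyIsotopic`, `Isotopy.lean`). (This is why the oriented
knot type of Rolfsen (1976), §1.A may be defined on images or on parametrisations
interchangeably.) Named fact (statement only).
[cite: HirschDT1976, Ch. 8, Thm. 8.1.3 (p. 180) and proof of Thm. 8.3.3 (p. 186)] -/
def isIsotopic_of_range_eq : Prop :=
  ∀ {K K' : Knot}, range K = range K' → SameOrientationAt K K' → K.IsIsotopic K'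

end Knot

namespace BandData

/-! ## The geometric heart: band sums with the same band have ambient isotopic images -/

/-- **Band sums with the same band have ambient isotopic oriented images.** Let `b`, `b'` be
band-sum data for the results `K`, `K'` with the same band map and collar width, and let `V`
be any open set containing the closure of the band surface `b.support = band '' squareNhd δ`.
Then there is an ambient isotopy `F` of `𝕊 3`, stationary outside `V`, whose final stage
carries the image of `K` onto the image of `K'`, the composite `F 1 ∘ K` inducing the same
orientation as `K'`. Proof sketch (folklore; the sources treat the band sum along a given
band as well defined without comment): outside the band surface `K` and `K'` have the same image
(`range_diff`); inside, they are the images of the arc systems (`lowerArc`, `upperArc`) resp.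
(`lowerArc'`, `upperArc'`), pairs of embedded regular arcs with the same endpoints in the
disjoint half-rectangles `{x₁ < 1/2}`, `{x₁ > 1/2}` of `squareNhd δ`; an embedded arc in a disc
is standard (planar Schoenflies; Hirsch (1976), Thm. 8.3.1 for the interior, with infinite-order
contact at the corner endpoints forced by smoothness of `K`, `K'`, `K₁`, `K₂` there), so each
pair is related by a compactly supported diffeotopy of its half-rectangle fixing the endpoints;
transported by the embedding `band` and tapered off in the normal direction of the band surface
inside `V` (and below the normal height of the arcs of `K₁ ∪ K₂` outside the band), these give
a diffeotopy of `𝕊 3` (Hirsch (1976), Thm. 8.1.1) carrying `range K` onto `range K'`; both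
results run from `band (0, -δ)` to `band (1, -δ)` along their lower arcs (`orient_result`), so
the orientations match. Gompf–Stipsicz (1999), §5.1 (the band sum along a given band is well
defined); Kirby (1989), Ch. I §2, p. 10. Together with `Knot.isIsotopic_of_range_eq` this gives
`BandData.isIsotopic_of_band_eq` (`BandData.isIsotopic_of_band_eq_of`, which uses `V = univ`
only). The support clause (monotone in `V`, and free in the construction: the track of the arc
isotopy lies over `band '' closure (squareNhd δ)`) is kept for the planned link-level consumer:
a band sum of one component of a link along a band avoiding the other components leaves them
fixed (handle slides, `KirbyMoves.lean`), which is what "isotopy fixed away from the band" in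
the docstring of `BandData` refers to. Named fact (statement only).
[cite: GompfStipsicz1999, §5.1] -/
def exists_ambientIsotopy_of_band_eq : Prop :=
  ∀ {K₁ K₂ K K' : Knot} {avoid avoid' : Set (𝕊 3)}
    (b : BandData K₁ K₂ K avoid) (b' : BandData K₁ K₂ K' avoid'), b.band = b'.band → b.δ = b'.δ →
    ∀ V : Set (𝕊 3), IsOpen V → closure b.support ⊆ V →
    ∃ F : AmbientIsotopy (𝓡 3) (𝕊 3), (∀ t, ∀ x ∉ V, F.toFun t x = x) ∧
      F.toFun 1 '' range K = range K' ∧ Knot.SameOrientationAt (F.toFun 1 ∘ K) K'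

/-! ## Assembly -/

/-- **Reduction.** The two named facts `BandData.exists_ambientIsotopy_of_band_eq` (set-level
geometry) and `Knot.isIsotopic_of_range_eq` (reparametrisation) imply that a band sum depends
only on the band, `BandData.isIsotopic_of_band_eq`: with `F` from the first fact (for
`V = univ`), `K` is isotopic to `K.map (F.toDiffeomorph 1) = F 1 ∘ K` by `F` itself
(`SphereEmbedding.isIsotopic_map`), `F 1 ∘ K` and `K'` have the same oriented image, hence are
isotopic by the second fact, and ambient isotopy is transitive (`IsAmbientIsotopic.trans_holds`).
Gompf–Stipsicz (1999), §5.1. [cite: GompfStipsicz1999, §5.1] -/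
theorem isIsotopic_of_band_eq_of (hgeom : exists_ambientIsotopy_of_band_eq)
    (hrep : Knot.isIsotopic_of_range_eq) : BandData.isIsotopic_of_band_eq := by
  intro K₁ K₂ K K' avoid avoid' b b' hband hδ
  obtain ⟨F, -, hrange, hor⟩ :=
    hgeom b b' hband hδ univ isOpen_univ (subset_univ _)
  have h₁ : K.IsIsotopic (K.map (F.toDiffeomorph 1)) := K.isIsotopic_map F
  have h₂ : (K.map (F.toDiffeomorph 1)).IsIsotopic K' :=
    hrep (by rw [SphereEmbedding.range_map, AmbientIsotopy.coe_toDiffeomorph, hrange]) hor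
  exact IsAmbientIsotopic.trans_holds h₁ h₂

end BandData

end Literature.Topology.FourManifolds
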